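import Literature.AnabelianGeometry.EtaleTheta.Discharge.Sec3Thm37Standard
import Literature.AlgebraicGeometry.Frobenioids.ModelFrobenioidModelType
import HarnessLib

/-!
# [EtTh] Theorem 3.7 (i), clause "of … model … type" — DISCHARGED in the tree's [FrdI] Def 4.5 (i)
# vocabulary, via [FrdI] Thm 5.2 (ii)

Proof-only sequel (theorems only, no definitions) of `Discharge/Sec3Thm37.lean` (abc-iut-L6-t13),
`Sec3Thm37SubQFT.lean` / `Sec3Thm37Holds.lean` (abc-iut-L1-t1) and `Sec3Thm37Standard.lean`.
S. Mochizuki, *The étale theta function …*, Publ. RIMS **45** (2009) [EtTh], §3, Theorem 3.7 (i),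
p. 79 = PDF p. 305 of `paper:doi-10-2977-prims-1234361159` [cite: MochizukiEtTh2009, Thm 3.7 (i) p.79]:

> "(i) … For arbitrary `Λ`, the Frobenioid `C` is of isotropic, model [hence, in particular,
> birationally Frobenius-normalized], and sub-quasi-Frobenius-trivial type, but not of group-like
> type."

and its proof, p. 80 = PDF p. 306: "it follows from [Mzk17], Theorem 5.2, (ii), that `C` is of
isotropic and model type".  In L2-t3's named `Prop` `TemperedFrobenioid.Thm37_i F` the clause "of model
type" is the FREE facade field `F.IsOfModelType` (TODO-merge [FrdI] Def 4.5 (i)) — not touched.  Its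
CONTENT is kernel-checked here in the tree's [FrdI] Def 4.5 (i) vocabulary
`Frobenioids.PreFrobenioid.IsOfModelType` ("pre-model [Def 2.7 (iii): admits a base-Frobenius pair] and
birationally Frobenius-normalized", `ModelFrobenioidComparison.lean`), since the tempered Frobenioid IS
the model Frobenioid `C₀.category = ModelFrobenioid Φ B Div_B` and [FrdI] Thm 5.2 (ii) "of model type"
is PROVED for every model Frobenioid over any base (`Frobenioids.ModelFrobenioid.isOfModelType`,
`ModelFrobenioidModelType.lean`; pre-model half `ModelFrobenioidBaseSectionSkeleton.lean`, birational
half abc-iut-L1-d10's `ModelFrobenioidBiratNormalized.lean`):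

* `isOfPreModelType_of` / `isOfPreModelType_treeCatVocab` — the tempered Frobenioid is of PRE-MODEL
  type; at the canonical vocabulary `treeCatVocab` this is UNCONDITIONAL (inputs: `Φ` divisorial = field
  `isDivisorialOn`, `B` group-like = `RealifiedDivisorMonoids.isUnit_BΛ`);
* `isOfModelType_of` / `isOfModelType_treeCatVocab` — of MODEL type at THE birationalization `C^birat`
  (square completion `hasBiratSquares_of_isFrobenioid`), given `hF` ([FrdI] Thm 5.2 (ii): `C → F_Φ` is a
  Frobenioid) resp., at `treeCatVocab`, L1-t1's single residual datum `hBmon : IsMonoidOn B`;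
* `thm37_i_treeClauses5_treeCatVocab` — the FIVE tree-vocabulary conjuncts of Thm 3.7 (i) together
  (isotropic · model · birationally Frobenius-normalized · sub-quasi-Frobenius-trivial · not group-like)
  modulo `hBmon` only; the remaining printed conjuncts "unit-profinite (`Λ = ℤ`) / unit-trivial
  (`Λ = ℝ`) type" depend on the data `B₀^Λ` beyond the interface (cf. the hypothesis `hdiv` of
  `Sec3Thm37*.lean`) and stay out of reach here — named, not assumed.

HONEST FRAMING: refereed pre-IUT material ([EtTh] §3 over [FrdI] §2/§4/§5); nothing here bears on
[IUTchIII] Cor. 3.12; no statement of either paper is strengthened; typed ≠ proved — here PROVED.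
-/

namespace Literature.AnabelianGeometry.EtaleTheta

open CategoryTheory Opposite Literature.AlgebraicGeometry.Frobenioids

universe u₀ v₀ u v w

variable {D₀ : Type u₀} [Category.{v₀} D₀] {V : FrdIMonoidStub.{w}}
  {T : RealifiedDivisorMonoids (D₀ := D₀) V} {D : Type u} [Category.{v} D]

namespace TemperedFrobenioid

section General

variable {VD : FrdICatStub.{u, v, w} D} (C₀ : TemperedFrobenioid T D VD)

/-- **Thm 3.7 (i), "of … model … type", pre-model half** ([FrdI] Def 2.7 (iii): `C` admits a
base-Frobenius pair), modulo the standing hypotheses of [FrdI] Thm 5.2 (only `Φ` divisorial and `B`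
group-like are used). [cite: MochizukiEtTh2009, Thm 3.7 (i) p.79] -/
theorem isOfPreModelType_of (hyp : ModelFrobenioid.Hypotheses C₀.divisorMonoid C₀.ratFnFunctor) :
    PreFrobenioid.IsOfPreModelType C₀.toElem :=
  ModelFrobenioid.isOfPreModelType_of_isDivisorial hyp.isDivisorial hyp.isGroupLike_rat

/-- **Thm 3.7 (i), "of … model [hence, in particular, birationally Frobenius-normalized] … type"**
([FrdI] Def 4.5 (i), the tree's `PreFrobenioid.IsOfModelType` at THE birationalization), modulo the
standing hypotheses of [FrdI] Thm 5.2 and `hF` ([FrdI] Thm 5.2 (ii): `C → F_Φ` is a Frobenioid) — "it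
follows from [Mzk17], Theorem 5.2, (ii), that `C` is of … model type" (p. 306).
[cite: MochizukiEtTh2009, Thm 3.7 (i) p.79] -/
theorem isOfModelType_of (hyp : ModelFrobenioid.Hypotheses C₀.divisorMonoid C₀.ratFnFunctor)
    (hF : PreFrobenioid.IsFrobenioid C₀.toElem) :
    PreFrobenioid.IsOfModelType C₀.toElem hF (PreFrobenioid.hasBiratSquares_of_isFrobenioid hF) :=
  ModelFrobenioid.isOfModelType hF hyp.isDivisorial hyp.isGroupLike_rat

end General

/-! ## At the canonical [FrdI] vocabulary `treeCatVocab` -/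

section TreeVocab

variable {IsRational IsStrictlyRational : (Dᵒᵖ ⥤ CommMonCat.{w}) → Prop}
  (C₀ : TemperedFrobenioid T D (treeCatVocab D IsRational IsStrictlyRational))

/-- **Thm 3.7 (i), pre-model type, at the canonical vocabulary — UNCONDITIONAL**: `Φ` is divisorial
(field `isDivisorialOn` read through `treeCatVocab`) and `B` is group-like (`isUnit_BΛ`), which is all the
zero-section-over-a-skeleton construction of [FrdI] Thm 5.2 needs. [cite: MochizukiEtTh2009, Thm 3.7 (i) p.79] -/
theorem isOfPreModelType_treeCatVocab : PreFrobenioid.IsOfPreModelType C₀.toElem :=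
  ModelFrobenioid.isOfPreModelType_of_isDivisorial C₀.isDivisorial_divisorMonoid
    C₀.ratFnFunctor_isGroupLike_holds

/-- **Thm 3.7 (i), "of model type", at the canonical vocabulary** — input `hBmon` only (then `hF` is L1's
[FrdI] Thm 5.2 (ii), `isFrobenioid_treeCatVocab_of_isMonoidOn`). [cite: MochizukiEtTh2009, Thm 3.7 (i) p.79] -/
theorem isOfModelType_treeCatVocab (hBmon : IsMonoidOn C₀.ratFnFunctor) :
    PreFrobenioid.IsOfModelType C₀.toElem (C₀.isFrobenioid_treeCatVocab_of_isMonoidOn hBmon)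
      (PreFrobenioid.hasBiratSquares_of_isFrobenioid
        (C₀.isFrobenioid_treeCatVocab_of_isMonoidOn hBmon)) :=
  C₀.isOfModelType_of (C₀.hypotheses_treeCatVocab hBmon)
    (C₀.isFrobenioid_treeCatVocab_of_isMonoidOn hBmon)

/-- **Thm 3.7 (i) — the five tree-vocabulary conjuncts together, at the canonical vocabulary**, modulo
`hBmon` only: "of isotropic, model [hence, in particular, birationally Frobenius-normalized], and
sub-quasi-Frobenius-trivial type, but not of group-like type" ([FrdI] Def 1.2 (iv)/(v), Def 4.5 (i)).
(The conjuncts "unit-profinite (`Λ = ℤ`) / unit-trivial (`Λ = ℝ`) type" are not reachable over the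
interface data `B₀^Λ`.) [cite: MochizukiEtTh2009, Thm 3.7 (i) p.79] -/
theorem thm37_i_treeClauses5_treeCatVocab (hBmon : IsMonoidOn C₀.ratFnFunctor) :
    PreFrobenioid.IsOfIsotropicType C₀.toElem ∧
      PreFrobenioid.IsOfModelType C₀.toElem (C₀.isFrobenioid_treeCatVocab_of_isMonoidOn hBmon)
        (PreFrobenioid.hasBiratSquares_of_isFrobenioid
          (C₀.isFrobenioid_treeCatVocab_of_isMonoidOn hBmon)) ∧
      PreFrobenioidData.IsOfBiratFrobeniusNormalizedType
        (PreFrobenioid.biratData (C₀.isFrobenioid_treeCatVocab_of_isMonoidOn hBmon)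
          (PreFrobenioid.hasBiratSquares_of_isFrobenioid
            (C₀.isFrobenioid_treeCatVocab_of_isMonoidOn hBmon))) ∧
      PreFrobenioid.IsOfType (PreFrobenioid.IsSubQuasiFrobeniusTrivial C₀.toElem) ∧
      ¬ PreFrobenioid.IsOfType (PreFrobenioid.IsGroupLikeObj C₀.toElem) :=
  ⟨C₀.thm37_i_isotropic_holds, C₀.isOfModelType_treeCatVocab hBmon,
    C₀.isOfBiratFrobeniusNormalizedType_treeCatVocab hBmon,
    (C₀.thm37_i_treeClauses_treeCatVocab_of_isMonoidOn hBmon).2.1, C₀.thm37_i_not_groupLike⟩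

end TreeVocab

end TemperedFrobenioid

end Literature.AnabelianGeometry.EtaleTheta
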